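import Summits.ABC.IUTFork.Cor312PilotIdelesMRead
import HarnessLib

/-!
# [IUTchIII] Corollary 3.12, statement — the pilot ideles at the M-level presentation are UNITS OF NORM `1` OFF THE
# INTRINSIC BAD SET `V̲^bad` (G1-Θ unit P4a, third file: the form of `ht1`/`htq1` the P4 holder abc-iut-s2-p8 binds,
# STATUS 10:03:07Z)

Record-only file (D-0012) of the abc-iut cell (seat abc-iut-w5-d033, gen 9; branch C «abc ⇐ S», C-R12 (e) target #2′).
TAKES NO SIDE on [IUTchIII] Cor. 3.12. PROOF-ONLY sequel of `Cor312PilotIdelesMRead` (p436273): there the side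
conditions `‖t‖ = 1` off the bad set are stated with the bad set of the PILOT DATA (`placeModOfM D u x ∉ (pilotData D).S`,
abc-iut-c312-7's `placeOf X p x ∉ X.S` shape). abc-iut-s2-p8's `settingPrVolSharpM` (unit P4) binds them on the
INTRINSIC bad set `V̲^bad` of abc-iut-c312-5's index skeleton `thetaIndexOfInitial D` ([IUTchI] Def. 3.1 (f):
"`V̲^bad := V̲ ∩ V^bad`", the members of `V̲` over `V^bad_mod`). HERE:

* **`mem_Vbad_iff_placeModOfM_mem_badPrimesMod`**: `x ∈ V̲^bad ↔ v(x) ∈ V^bad_mod` — the bridge between the two bad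
  sets at a member `x` of the fibre over a nonarchimedean `u` (`toVMod x = v(x)`, p436273, and L5-t2's
  `D.Vbad = {w ∈ V̲ | toVMod w ∈ V^bad_mod}`);
* **`norm_tThetaM_eq_one_of_not_mem_Vbad`**, **`norm_tqM_eq_one_of_not_mem_Vbad`** — `ht1`/`htq1` in P4's shape
  `x.1 ∉ (thetaIndexOfInitial D).Vbad → ‖t … x‖ = 1`, for idele data `r` and (`…_ideleDataOf`) on a volume input `I`.

[cite: Mochizuki2012, IUTchI Def. 3.1 (b)(e)(f) p. 61–62] [cite: DupuyHilado2025, §3.3, §3.4]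
[claim: Mochizuki2012, status: disputed] for the quoted setting. HONEST FRAMING: bookkeeping over OUR typed objects;
nothing here bears on the truth of [IUTchIII] Cor. 3.12; typed ≠ proved; instantiated ≠ endorsed.
-/

noncomputable section

open Set Function NumberField IsDedekindDomain
open scoped Pointwise

namespace Summit.ABC.IUTFork.Thm311.Real

open Cor312Vol Literature.IUT.LogThetaLattice Literature.IUT.LogVolume Literature.IUT.HodgeTheaters
  Literature.NumberTheory.NumberFields

variable {F K Fbar : Type} [Field F] [NumberField F] [Field K] [NumberField K] [Algebra F K]
  [Field Fbar] [Algebra F Fbar] [Algebra K Fbar] {E : WeierstrassCurve F} [E.IsElliptic] {l : ℕ}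
  {Pb : BadPlacePredicates K} (D : InitialThetaData F K Fbar E l Pb)
  (p : ℕ) [hp : Fact p.Prime] (u : FinitePlace ℚ) (hu : ((p : ℕ) : 𝓞 ℚ) ∈ (FinitePlace.maximalIdeal u).asIdeal)

/-! ## The two bad sets at a member of the fibre -/

/-- **`x ∈ V̲^bad ↔ v(x) ∈ V^bad_mod`**: a member `x` of the fibre of `V̲ → V_ℚ` over the nonarchimedean place `u` lies
in the intrinsic bad set `V̲^bad` of the index skeleton iff the place `v(x) = placeModOfM D u x` of `F_mod` under it
is one of the bad primes `V^bad_mod` (= the bad set `S` of `D`'s pilot data). [cite: Mochizuki2012, IUTchI Def. 3.1 (f) p. 62] -/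
theorem mem_Vbad_iff_placeModOfM_mem_badPrimesMod (x : (thetaIndexOfInitial D).Fibre (Val.non u)) :
    x.1 ∈ (thetaIndexOfInitial D).Vbad ↔ placeModOfM D u x ∈ ThetaData.badPrimesMod D := by
  refine (mem_thetaIndexOfInitial_Vbad_iff D x.1).trans ?_
  rw [ThetaData.mem_badPrimesMod_iff, toVMod_val_eq_non_placeModOfM]
  constructor
  · rintro ⟨w, hw, hwx⟩
    have h : w = FinitePlace.mk (placeModOfM D u x) := Sum.inr_injective hwx
    rwa [← h]
  · intro h
    exact ⟨_, h, rfl⟩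

/-- The same with the bad set `S` of `D`'s pilot data (`(pilotData D).S = badPrimesMod D`, definitionally).
[cite: Mochizuki2012, IUTchI Def. 3.1 (f) p. 62] -/
theorem mem_Vbad_iff_placeModOfM_mem_S (x : (thetaIndexOfInitial D).Fibre (Val.non u)) :
    x.1 ∈ (thetaIndexOfInitial D).Vbad ↔ placeModOfM D u x ∈ (ThetaData.pilotData D).S :=
  mem_Vbad_iff_placeModOfM_mem_badPrimesMod D u x

/-! ## `ht1` / `htq1` on the intrinsic bad set -/

section Ideles

variable (r : ThetaData.IdeleData D)

/-- **`ht1` in unit P4's shape**: off `V̲^bad` the Θ-idele at the presentation has norm `1`.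
[cite: DupuyHilado2025, §3.3, §3.4] -/
theorem norm_tThetaM_eq_one_of_not_mem_Vbad (i : Fin (thetaIndexOfInitial D).lstar)
    (x : (thetaIndexOfInitial D).Fibre (Val.non u)) (hx : x.1 ∉ (thetaIndexOfInitial D).Vbad) :
    ‖tThetaM D p u hu r i x‖ = 1 :=
  norm_tThetaM_eq_one_of_not_mem D p u hu r i x (mt (mem_Vbad_iff_placeModOfM_mem_S D u x).mpr hx)

/-- **`htq1` in unit P4's shape**: off `V̲^bad` the `q`-idele at the presentation has norm `1`.
[cite: DupuyHilado2025, §3.3, §3.4] -/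
theorem norm_tqM_eq_one_of_not_mem_Vbad (x : (thetaIndexOfInitial D).Fibre (Val.non u))
    (hx : x.1 ∉ (thetaIndexOfInitial D).Vbad) : ‖tqM D p u hu r x‖ = 1 :=
  norm_tqM_eq_one_of_not_mem D p u hu r x (mt (mem_Vbad_iff_placeModOfM_mem_S D u x).mpr hx)

/-- Conversely, AT a bad member the Θ-idele in degree `i+1` has `log ‖t‖ = −(i+1)²·ord_v(q_v)/(2l)·ln|κ(v)|/n_v < 0`-shape
value given by the pilot divisor; recorded as the (3.4) identity specialised to `v(x) ∈ V^bad_mod`.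
[cite: DupuyHilado2025, §3.3, §3.4] -/
theorem log_norm_tThetaM_of_mem_Vbad (i : Fin (thetaIndexOfInitial D).lstar)
    (x : (thetaIndexOfInitial D).Fibre (Val.non u)) (hx : x.1 ∈ (thetaIndexOfInitial D).Vbad) :
    Real.log ‖tThetaM D p u hu r i x‖ =
      -((((i : ℕ) + 1 : ℝ) ^ 2) * ((ThetaData.pilotData D).ordq (placeModOfM D u x) : ℝ) /
          (2 * (ThetaData.pilotData D).l)) * logNorm (fieldOfModuli E) (placeModOfM D u x) /
        localDegree (fieldOfModuli E) (placeModOfM D u x) := by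
  rw [log_norm_tThetaM, PilotData.thetaPilot_apply_of_mem (ThetaData.pilotData D) i
    ((mem_Vbad_iff_placeModOfM_mem_S D u x).mp hx)]

/-- … and the `q`-idele has `log ‖t_q‖ = −(ord_v(q_v)/(2l))·ln|κ(v)|/n_v` at a bad member. [cite: DupuyHilado2025, §3.3, §3.4] -/
theorem log_norm_tqM_of_mem_Vbad (x : (thetaIndexOfInitial D).Fibre (Val.non u))
    (hx : x.1 ∈ (thetaIndexOfInitial D).Vbad) :
    Real.log ‖tqM D p u hu r x‖ =
      -(((ThetaData.pilotData D).ordq (placeModOfM D u x) : ℝ) / (2 * (ThetaData.pilotData D).l)) *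
          logNorm (fieldOfModuli E) (placeModOfM D u x) / localDegree (fieldOfModuli E) (placeModOfM D u x) := by
  rw [log_norm_tqM, PilotData.qPilot_apply_of_mem (ThetaData.pilotData D)
    ((mem_Vbad_iff_placeModOfM_mem_S D u x).mp hx)]

end Ideles

/-! ## The same on a volume input `I` -/

/-- `ht1` in unit P4's shape for the ideles of a volume input `I` of `D`. [cite: DupuyHilado2025, §3.3, §3.4] -/
theorem norm_tThetaM_ideleDataOf_eq_one_of_not_mem_Vbad {I : ThetaVolumeInput (fieldOfModuli E) K}
    (hI : ThetaData.IsVolumeInputOf D I) (i : Fin (thetaIndexOfInitial D).lstar)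
    (x : (thetaIndexOfInitial D).Fibre (Val.non u)) (hx : x.1 ∉ (thetaIndexOfInitial D).Vbad) :
    ‖tThetaM D p u hu (ideleDataOf D hI) i x‖ = 1 :=
  norm_tThetaM_eq_one_of_not_mem_Vbad D p u hu _ i x hx

/-- `htq1` in unit P4's shape for the ideles of a volume input `I` of `D`. [cite: DupuyHilado2025, §3.3, §3.4] -/
theorem norm_tqM_ideleDataOf_eq_one_of_not_mem_Vbad {I : ThetaVolumeInput (fieldOfModuli E) K}
    (hI : ThetaData.IsVolumeInputOf D I) (x : (thetaIndexOfInitial D).Fibre (Val.non u))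
    (hx : x.1 ∉ (thetaIndexOfInitial D).Vbad) : ‖tqM D p u hu (ideleDataOf D hI) x‖ = 1 :=
  norm_tqM_eq_one_of_not_mem_Vbad D p u hu _ x hx

end Summit.ABC.IUTFork.Thm311.Real

end
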